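/-
Copyright (c) 2026 the pub-hodgecm-mathlib formalisation cell (harness21).  Prover seat hodgecm-mathlib-K2E4-p23 (g2), Track B ∕ K2-LIT, h413 =
`stmt-HodgeConjecture-24833`, ENGINE E1, 5Res campaign «ENDGAME BY FAMILIES» (ROADCARD (154) of the dealer K2E1-plan (g7), §2 C6 second half ∕ §3 D3 (T7-κ), pre-deal (157)
«D3-lite in the circle-average currency»).
-/
import Summits.HodgeConjecture.HodgeConjecture.Theorems.K2E1ArchTorusCoefficientExpansionU11   -- ★ p859568 (this seat) F2b: `exists_hasDerivAt_archTorusCoeff_exp`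
import HarnessLib

/-!
# K2·E1 — `K2E1ArchCentralSymbolsSeparateU11`: THE ARCHIMEDEAN SYMBOL FAMILY `{a ↦ Φ_{s,m}(a)}_{a>0}` SEPARATES THE PARAMETER `s` UP TO `s ↦ 1 − s`, AT EVERY `K_w`-TYPE `m`
# (ROADCARD «5Res ENDGAME BY FAMILIES» §3 D3 (T7-κ) ∕ §2 C6 second half, circle-average edition)

Track B ∕ K2-LIT, crux h413 = `stmt-HodgeConjecture-24833`, route of record `HCCMUnconditional`; cell `hodgecm-mathlib`, squad K2, ENGINE E1 (5Res campaign).  Prover seat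
`hodgecm-mathlib-K2E4-p23` (g2); pre-deal (157) of K2E1-plan (g7).  THEOREMS ONLY (no `def`, no `instance`, no notation, no named-fact hypothesis, no `sorry`); lane
`--supports stmt-HodgeConjecture-24833 --as helper` (count-neutral).  CLOSES NO SOCKET.

THE POINT.  At the complex place `w`, the arch-central device acting on vectors of `K_w`-type `(p, q)` in ★ (113)'s currency is «circle-average ∘ torus-translate by `t_w(a)`»; on the
principal series `I(χ_w, s)` it acts by the scalar `Φ_{s,m}(a) = archTorusCoeff s m a`, `m = p − q` (★ F2a∕(113)).  ★ F2b computed the second `u`-Taylor coefficient of `u ↦ Φ_{s,m}(e^u)` at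
`u = 0`: it is `s² − s − m²∕4`.  Hence the FAMILY of scalars `{Φ_{s,m}(a)}_{a>0}` determines `s² − s`, i.e. `{s, 1 − s}`:
* §1 `sq_sub_self_eq_of_forall_archTorusCoeff_eq`, **`eq_or_eq_one_sub_of_forall_archTorusCoeff_eq`**: `(∀ a > 0, Φ_{s,m}(a) = Φ_{s′,m}(a)) → s′ = s ∨ s′ = 1 − s`;
* §2 **`archTorusCoeff_separates_unitaryAxis`** (D3 ∕ T7-κ): on the unitary axis `s = ½ + iy` the family separates `y` from every `y′ ≠ ±y`; `archTorusCoeff_separates_realLine`: on the real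
  line it separates `σ` from every `σ′ ∉ {σ, 1 − σ}`;
* §3 **`exists_archTorusCoeff_ne`** (C6 second half at general κ, `hnc`-type): for `s′ ∉ {s, 1 − s}` some `a > 0` has `Φ_{s,m}(a) ≠ Φ_{s′,m}(a)` — the symbol family is NOT constant in
  the parameter.
NOT CLAIMED: non-constancy of `s ↦ Φ_{s,m}(a)` for ONE fixed `a ≠ 1`; the `C_c(U(1,1)(ℝ))`-test-function edition (12d-C's operator currency).
HONEST LABEL: HC_CM is proved only modulo the 7 printed citations (2 remaining named inputs: hLiu418 = `stmt-HodgeConjecture-24832`, h413 = `stmt-HodgeConjecture-24833`) until rung 0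
closes; this file asserts no named fact and closes no socket; count-neutral.

## References
* [Knapp1986] A. W. Knapp, *Representation Theory of Semisimple Groups* (1986), VII §1, VIII §7 (spherical functions and the Casimir eigenvalue `s(1 − s)`-type parameter).
* [Bump1997] D. Bump, *Automorphic Forms and Representations* (1997), §2.6 Thm. 2.6.3.
* [MoeglinWaldspurger1995] C. Mœglin, J.-L. Waldspurger (1995), IV.3.
-/

set_option autoImplicit false
-- the mandated namespace repeats the single-problem summit's segment (`HodgeConjecture.HodgeConjecture`)
set_option linter.dupNamespace false

noncomputable section

open Summit.HodgeConjecture.HodgeConjecture.Cruxes.H413.K2E1ArchTorusCoefficientU11Defs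
open Summit.HodgeConjecture.HodgeConjecture.Cruxes.H413.K2E1ArchTorusCoefficientExpansionU11 (exists_hasDerivAt_archTorusCoeff_exp)

namespace Summit.HodgeConjecture.HodgeConjecture.Cruxes.H413.K2E1ArchCentralSymbolsSeparateU11

/-! ## §1 The symbol family determines `s² − s` -/

/-- **THE SYMBOL FAMILY DETERMINES `s² − s`**: if `Φ_{s,m}(a) = Φ_{s′,m}(a)` for all `a > 0` then `s² − s = s′² − s′` (the second `u`-derivatives of `u ↦ Φ(e^u)` at `0` agree; ★ F2b
`exists_hasDerivAt_archTorusCoeff_exp`, Mathlib `HasDerivAt.unique`). [cite: Knapp1986, VII §1] [cite: Bump1997, §2.6] -/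
theorem sq_sub_self_eq_of_forall_archTorusCoeff_eq {s s' : ℂ} {m : ℤ} (h : ∀ a : ℝ, 0 < a → archTorusCoeff s m a = archTorusCoeff s' m a) :
    s ^ 2 - s = s' ^ 2 - s' := by
  obtain ⟨F, hF, hF0⟩ := exists_hasDerivAt_archTorusCoeff_exp s m
  obtain ⟨G, hG, hG0⟩ := exists_hasDerivAt_archTorusCoeff_exp s' m
  have hfun : (fun u : ℝ => archTorusCoeff s' m (Real.exp u)) = fun u : ℝ => archTorusCoeff s m (Real.exp u) :=
    funext fun u => (h _ (Real.exp_pos u)).symm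
  have hFG : F = G := by
    funext u
    have hG' : HasDerivAt (fun u : ℝ => archTorusCoeff s m (Real.exp u)) (G u) u := hfun ▸ hG u
    exact (hF u).unique hG'
  rw [hFG] at hF0
  have h2 := hF0.unique hG0
  linear_combination (1 / 2 : ℂ) * h2

/-- **THE SYMBOL FAMILY SEPARATES `s` UP TO `s ↦ 1 − s`**: `(∀ a > 0, Φ_{s,m}(a) = Φ_{s′,m}(a)) → s′ = s ∨ s′ = 1 − s`. [cite: Knapp1986, VII §1] [cite: Bump1997, §2.6] -/
theorem eq_or_eq_one_sub_of_forall_archTorusCoeff_eq {s s' : ℂ} {m : ℤ} (h : ∀ a : ℝ, 0 < a → archTorusCoeff s m a = archTorusCoeff s' m a) :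
    s' = s ∨ s' = 1 - s := by
  have h1 := sq_sub_self_eq_of_forall_archTorusCoeff_eq h
  have h2 : (s' - s) * (s' - (1 - s)) = 0 := by linear_combination -h1
  rcases mul_eq_zero.1 h2 with h3 | h3
  · exact Or.inl (sub_eq_zero.1 h3)
  · exact Or.inr (sub_eq_zero.1 h3)

/-! ## §2 On the unitary axis and on the real line -/

/-- **D3 (T7-κ), CIRCLE-AVERAGE EDITION: ON THE UNITARY AXIS THE SYMBOL FAMILY SEPARATES `y` FROM EVERY `y′ ≠ ±y`**:
`(∀ a > 0, Φ_{½+iy,m}(a) = Φ_{½+iy′,m}(a)) → y′ = y ∨ y′ = −y`. [cite: Knapp1986, VII §1] [cite: MoeglinWaldspurger1995, IV.3] -/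
theorem archTorusCoeff_separates_unitaryAxis {y y' : ℝ} {m : ℤ}
    (h : ∀ a : ℝ, 0 < a → archTorusCoeff (1 / 2 + y * Complex.I) m a = archTorusCoeff (1 / 2 + y' * Complex.I) m a) :
    y' = y ∨ y' = -y := by
  rcases eq_or_eq_one_sub_of_forall_archTorusCoeff_eq h with h1 | h1
  · left
    have h2 := congrArg Complex.im h1
    simpa using h2
  · right
    have h2 := congrArg Complex.im h1
    simp at h2
    linarith

/-- On the real line the symbol family separates `σ` from every `σ′ ∉ {σ, 1 − σ}`. [cite: Knapp1986, VII §1] -/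
theorem archTorusCoeff_separates_realLine {σ σ' : ℝ} {m : ℤ}
    (h : ∀ a : ℝ, 0 < a → archTorusCoeff (σ : ℂ) m a = archTorusCoeff (σ' : ℂ) m a) :
    σ' = σ ∨ σ' = 1 - σ := by
  rcases eq_or_eq_one_sub_of_forall_archTorusCoeff_eq h with h1 | h1
  · exact Or.inl (by exact_mod_cast h1)
  · right
    have h2 := congrArg Complex.re h1
    simpa using h2

/-! ## §3 Non-constancy of the family in the parameter -/

/-- **C6 SECOND HALF AT GENERAL κ (`hnc`-type): THE SYMBOL FAMILY IS NOT CONSTANT IN THE PARAMETER** — for `s′ ∉ {s, 1 − s}` some `a > 0` has `Φ_{s,m}(a) ≠ Φ_{s′,m}(a)`.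
[cite: Knapp1986, VII §1] [cite: Bump1997, §2.6] -/
theorem exists_archTorusCoeff_ne {s s' : ℂ} (m : ℤ) (hs : s' ≠ s) (hs' : s' ≠ 1 - s) :
    ∃ a : ℝ, 0 < a ∧ archTorusCoeff s m a ≠ archTorusCoeff s' m a := by
  by_contra hcon
  push Not at hcon
  rcases eq_or_eq_one_sub_of_forall_archTorusCoeff_eq (m := m) hcon with h1 | h1
  · exact hs h1
  · exact hs' h1

/-- On the unitary axis: for `y′ ≠ ±y` some `a > 0` has `Φ_{½+iy,m}(a) ≠ Φ_{½+iy′,m}(a)`. [cite: Knapp1986, VII §1] -/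
theorem exists_archTorusCoeff_ne_unitaryAxis {y y' : ℝ} (m : ℤ) (hy : y' ≠ y) (hy' : y' ≠ -y) :
    ∃ a : ℝ, 0 < a ∧ archTorusCoeff (1 / 2 + y * Complex.I) m a ≠ archTorusCoeff (1 / 2 + y' * Complex.I) m a := by
  by_contra hcon
  push Not at hcon
  rcases archTorusCoeff_separates_unitaryAxis (m := m) hcon with h1 | h1
  · exact hy h1
  · exact hy' h1

/-! ## §4 (ROADCARD §3′ D3 corollary) Rational torus parameters suffice: continuity in `a` -/

/-- `a ↦ Φ_{s,m}(a)` is continuous on `(0, ∞)` (★ F2b: `u ↦ Φ_{s,m}(e^u)` is differentiable). [cite: Knapp1986, VII §1] -/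
theorem continuousOn_archTorusCoeff (s : ℂ) (m : ℤ) : ContinuousOn (archTorusCoeff s m) (Set.Ioi 0) := by
  obtain ⟨F, hF, -⟩ := exists_hasDerivAt_archTorusCoeff_exp s m
  have hc : Continuous fun u : ℝ => archTorusCoeff s m (Real.exp u) := continuous_iff_continuousAt.2 fun u => (hF u).continuousAt
  refine ((hc.comp_continuousOn Real.continuousOn_log).mono fun a ha => ne_of_gt (Set.mem_Ioi.1 ha)).congr fun a ha => ?_
  simp only [Function.comp_apply, Real.exp_log (Set.mem_Ioi.1 ha)]

/-- The logarithms of the positive rationals are dense in `ℝ`. [folklore] -/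
theorem denseRange_log_ratCast : DenseRange fun q : {q : ℚ // (0 : ℝ) < q} => Real.log (q : ℝ) := by
  refine Metric.denseRange_iff.2 fun u ε hε => ?_
  obtain ⟨q, hq1, hq2⟩ := exists_rat_btwn (Real.exp_lt_exp.2 (show u - ε / 2 < u + ε / 2 by linarith))
  have hq0 : (0 : ℝ) < q := (Real.exp_pos _).trans hq1
  refine ⟨⟨q, hq0⟩, ?_⟩
  have h1 : u - ε / 2 < Real.log q := by
    have := Real.log_lt_log (Real.exp_pos _) hq1; rwa [Real.log_exp] at this
  have h2 : Real.log q < u + ε / 2 := by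
    have := Real.log_lt_log hq0 hq2; rwa [Real.log_exp] at this
  rw [Real.dist_eq, abs_lt]
  constructor <;> linarith

/-- **RATIONAL TORUS PARAMETERS SUFFICE**: if `Φ_{s,m}(q) = Φ_{s′,m}(q)` for all RATIONAL `q > 0` then for all real `a > 0` (continuity in `a`, density of `log ℚ_{>0}`), hence
`s′ = s ∨ s′ = 1 − s` (§1). [cite: Knapp1986, VII §1] -/
theorem eq_or_eq_one_sub_of_forall_rat_archTorusCoeff_eq {s s' : ℂ} {m : ℤ} (h : ∀ q : ℚ, (0 : ℝ) < q → archTorusCoeff s m q = archTorusCoeff s' m q) :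
    s' = s ∨ s' = 1 - s := by
  obtain ⟨F, hF, -⟩ := exists_hasDerivAt_archTorusCoeff_exp s m
  obtain ⟨G, hG, -⟩ := exists_hasDerivAt_archTorusCoeff_exp s' m
  have hcF : Continuous fun u : ℝ => archTorusCoeff s m (Real.exp u) := continuous_iff_continuousAt.2 fun u => (hF u).continuousAt
  have hcG : Continuous fun u : ℝ => archTorusCoeff s' m (Real.exp u) := continuous_iff_continuousAt.2 fun u => (hG u).continuousAt
  have heq : (fun u : ℝ => archTorusCoeff s m (Real.exp u)) = fun u : ℝ => archTorusCoeff s' m (Real.exp u) := by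
    refine denseRange_log_ratCast.equalizer hcF hcG (funext fun q => ?_)
    simp only [Function.comp_apply, Real.exp_log q.2]
    exact h q.1 q.2
  refine eq_or_eq_one_sub_of_forall_archTorusCoeff_eq (m := m) fun a ha => ?_
  have := congrFun heq (Real.log a)
  simpa only [Real.exp_log ha] using this

/-- **ROADCARD §3′ D3 COROLLARY (the atom meets a spectral line in ≤ 2 points)**: on the line `s = ½ + i(· + t)`, if `Φ_{½+i(y′+t),m}(q) = Φ_{½+i(y+t),m}(q)` for all rational `q > 0`,
then `y′ = y ∨ y′ = −y − 2t`. [cite: Knapp1986, VII §1] [cite: MoeglinWaldspurger1995, IV.3] -/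
theorem eq_or_eq_neg_sub_of_forall_rat_archTorusCoeff_eq {y y' t : ℝ} {m : ℤ}
    (h : ∀ q : ℚ, (0 : ℝ) < q → archTorusCoeff (1 / 2 + (y' + t) * Complex.I) m q = archTorusCoeff (1 / 2 + (y + t) * Complex.I) m q) :
    y' = y ∨ y' = -y - 2 * t := by
  have h' : ∀ q : ℚ, (0 : ℝ) < q → archTorusCoeff (1 / 2 + (((y + t : ℝ)) : ℂ) * Complex.I) m q = archTorusCoeff (1 / 2 + (((y' + t : ℝ)) : ℂ) * Complex.I) m q :=
    fun q hq => by push_cast; exact (h q hq).symm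
  rcases eq_or_eq_one_sub_of_forall_rat_archTorusCoeff_eq h' with h1 | h1
  · left
    have h2 := congrArg Complex.im h1
    simp at h2
    linarith
  · right
    have h2 := congrArg Complex.im h1
    simp at h2
    linarith

end Summit.HodgeConjecture.HodgeConjecture.Cruxes.H413.K2E1ArchCentralSymbolsSeparateU11

end
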